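import Summits.ResolutionOfSingularities.ResolutionOfSingularities.Theses.MaxContactCut
import Summits.ResolutionOfSingularities.ResolutionOfSingularities.Theorems.FaceFormCutClasses
import Summits.ResolutionOfSingularities.ResolutionOfSingularities.Theorems.MaxContactCutTauLadder
import Summits.ResolutionOfSingularities.ResolutionOfSingularities.Theorems.MaxContactCutGenericPointCut
import Summits.ResolutionOfSingularities.ResolutionOfSingularities.Theorems.MaxContactCutForcedTowers
import HarnessLib

/-!
# MaxContactCutFaceFormCut — the g9 node «FaceFormCut» wired to the route MaxContactCut BY NAME
(decomp-res node N50, lens-2 g9 sha256 c1beb67c77f16f90; CRITIC-LEDGER row 60 CLEARED; phase 3)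

Vocabulary: `Theorems/FaceFormCutClasses` (phase 1: the FACE FORM `Φ_y` of a core top point, `SeqGen n` /
`SeqSpec n` / `SeqSpecDeep n` / `SeqSpecCritical n`, the typed engine `FaceFormExit`, the ports `OneShotPort n` /
`OrderOneContact`, and the exact cuts `seqDimFour_one_iff`, `seqSpec_iff`).  Route asides (MaxContactCut rev 15,
`aside · rank 9`, refining `RungOne` 29273): `FFGenericRung` [DECIDED-MOD-PORT, prover item; engine = prover
target #19], `FFSpecialRung` [located residual, score 0], `FFSpecialDeep` / `FFSpecialCritical` [UNDECIDED ·
INSTRUMENTABLE strata].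

Kernels (all by name, 0 sorry):
* EXACT at the rung: `RungOne ⟺ FFGenericRung ∧ FFSpecialRung` (`rungOne_iff`, pure logic), and the residual cut
  `FFSpecialRung ⟺ FFSpecialDeep ∧ FFSpecialCritical` (`specialRung_iff_strata`);
* DECIDED HALF: `FFGenericRung` from the engine and the two ports (`genericRung_of_engine`), so
  `closes_of_engine : FaceFormExit → (∀ n ≥ 2, OneShotPort n) → OrderOneContact → FFSpecialRung → RungOne`;
* MAP EDGES: to the located core 28544 (`closes_core`, via `MaxContactCutTauLadder.closes`), to g7's closed-point
  core `ClosedPointCoreAll` 30461 (`closes_closedPointCore`, via `MaxContactCutGenericPointCut`), and to `E 1`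
  (`e_one_of_pieces`, via `MaxContactCutForcedTowers.rungOne_iff_of_e_two`).  ROOT BY NAME is the route's `closes`.
WHY THIS IS NOVEL (critic row 60): no other node reads the located core point through the FIRST FACE of its
characteristic polyhedron — the face form is a static invariant of degree `n + 1` on `P(Dir_y)` whose generic
stratum is decided at EVERY `(p, n)` and every residue field by one blow-up, transverse to FedderCut and to
lens-5's shallow column.  Census data: HOME/CRITIC-LEDGER.md row 60; lens sha256 c1beb67c77f16f90;
census/face_bed.py (117+9 bed specimens, all face-special).  (Sources: CossartPiltant2008 Prop. 4.2, Lemma 4.3;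
Hironaka1970 Thm 2; CossartJannsenSaito2020; CossartPiltant2019 Rem. 3.2; Giraud1975.)
-/

namespace Summit.ResolutionOfSingularities.ResolutionOfSingularities.Theorems.MaxContactCutFaceFormCut

open CategoryTheory AlgebraicGeometry
open Literature.AlgebraicGeometry.Resolution
open Summit.ResolutionOfSingularities.ResolutionOfSingularities.Theses
open Summit.ResolutionOfSingularities.ResolutionOfSingularities.Theorems
open WeakOrderReduction FaceFormCutClasses

/-! ## The asides unfolded -/

/-- `FFGenericRung` is the generic half. [folklore] -/
theorem ffGenericRung_iff : MaxContactCut.FFGenericRung ↔ GenericRung := Iff.rfl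

/-- `FFSpecialRung` is the located residual. [folklore] -/
theorem ffSpecialRung_iff : MaxContactCut.FFSpecialRung ↔ SpecialRung := Iff.rfl

/-- `FFSpecialDeep` is the deep stratum at every marking. [folklore] -/
theorem ffSpecialDeep_iff : MaxContactCut.FFSpecialDeep ↔ (E 2 → ∀ n : ℕ, 1 ≤ n → SeqSpecDeep n) := Iff.rfl

/-- `FFSpecialCritical` is the critical stratum at every marking. [folklore] -/
theorem ffSpecialCritical_iff : MaxContactCut.FFSpecialCritical ↔ (E 2 → ∀ n : ℕ, 1 ≤ n → SeqSpecCritical n) :=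
  Iff.rfl

/-! ## EXACT at the rung (pure logic) -/

/-- **EXACT**: `RungOne ⟺ FFGenericRung ∧ FFSpecialRung` (excluded middle on «some top point is face-special»,
marking by marking). [folklore] -/
theorem rungOne_iff : MaxContactCut.RungOne ↔ MaxContactCut.FFGenericRung ∧ MaxContactCut.FFSpecialRung := by
  constructor
  · intro h
    exact ⟨fun hE2 n hn => seqGen_of_seqDimFour_one (h hE2 n hn),
      fun hE2 n hn => seqSpec_of_seqDimFour_one (h hE2 n hn)⟩
  · rintro ⟨hG, hS⟩ hE2 n hn
    exact seqDimFour_one_iff.mpr ⟨hG hE2 n hn, hS hE2 n hn⟩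

/-- NECESSITY by letter: the generic half is implied by the rung. [folklore] -/
theorem genericRung_of_rungOne (h : MaxContactCut.RungOne) : MaxContactCut.FFGenericRung := (rungOne_iff.mp h).1

/-- NECESSITY by letter: the located residual is implied by the rung. [folklore] -/
theorem specialRung_of_rungOne (h : MaxContactCut.RungOne) : MaxContactCut.FFSpecialRung := (rungOne_iff.mp h).2

/-- HONESTY KERNEL: modulo the (decided) generic half, the located residual IS the rung. [folklore] -/
theorem specialRung_iff_rungOne (hG : MaxContactCut.FFGenericRung) :
    MaxContactCut.FFSpecialRung ↔ MaxContactCut.RungOne :=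
  ⟨fun hS => rungOne_iff.mpr ⟨hG, hS⟩, specialRung_of_rungOne⟩

/-- **DECIDING IMPLICATION OF THE NODE**: `RungOne` (29273) BY NAME from the two halves. [folklore] -/
theorem closes (hG : MaxContactCut.FFGenericRung) (hS : MaxContactCut.FFSpecialRung) : MaxContactCut.RungOne :=
  rungOne_iff.mpr ⟨hG, hS⟩

/-- **EXACT residual cut**: `FFSpecialRung ⟺ FFSpecialDeep ∧ FFSpecialCritical`. [folklore] -/
theorem specialRung_iff_strata :
    MaxContactCut.FFSpecialRung ↔ MaxContactCut.FFSpecialDeep ∧ MaxContactCut.FFSpecialCritical :=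
  FaceFormCutClasses.specialRung_iff_strata

/-- The two strata give the located residual. [folklore] -/
theorem specialRung_of_strata (hD : MaxContactCut.FFSpecialDeep) (hC : MaxContactCut.FFSpecialCritical) :
    MaxContactCut.FFSpecialRung :=
  specialRung_iff_strata.mpr ⟨hD, hC⟩

/-- `RungOne` BY NAME from the generic half and the two strata. [folklore] -/
theorem closes_of_strata (hG : MaxContactCut.FFGenericRung) (hD : MaxContactCut.FFSpecialDeep)
    (hC : MaxContactCut.FFSpecialCritical) : MaxContactCut.RungOne :=
  closes hG (specialRung_of_strata hD hC)

/-! ## The decided half -/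

/-- **`FFGenericRung` is DECIDED modulo the typed pieces**: the engine `FaceFormExit` (prover target #19), the
bookkeeping port at every marking `≥ 2`, and the order-one contact port. [folklore] -/
theorem genericRung_of_engine (hE : FaceFormExit) (hP : ∀ n : ℕ, 2 ≤ n → OneShotPort n) (h1 : OrderOneContact) :
    MaxContactCut.FFGenericRung :=
  FaceFormCutClasses.genericRung_of_engine hE hP h1

/-- `RungOne` BY NAME from the typed ENGINE, the ports and the located residual. [folklore] -/
theorem closes_of_engine (hE : FaceFormExit) (hP : ∀ n : ℕ, 2 ≤ n → OneShotPort n) (h1 : OrderOneContact)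
    (hS : MaxContactCut.FFSpecialRung) : MaxContactCut.RungOne :=
  closes (genericRung_of_engine hE hP h1) hS

/-! ## Map edges BY NAME -/

/-- The two halves give `E 1` under `E 2`. [folklore] -/
theorem e_one_of_pieces (hE2 : E 2) (hG : MaxContactCut.FFGenericRung) (hS : MaxContactCut.FFSpecialRung) : E 1 :=
  (MaxContactCutForcedTowers.rungOne_iff_of_e_two hE2).1 (closes hG hS)

/-- MAP EDGE to the located core `StepPICoreDimFour` (28544) BY NAME, through `MaxContactCutTauLadder.closes`
(lens-5's contact family, the rungs R4–R2 and the costume `SequenceToStepAll`). [folklore] -/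
theorem closes_core (h5 : MaxContactCutExhaustion.ContactOrderSequenceDimFour) (r4 : MaxContactCut.RungFour)
    (r3 : MaxContactCut.RungThree) (r2 : MaxContactCut.RungTwo) (hG : MaxContactCut.FFGenericRung)
    (hS : MaxContactCut.FFSpecialRung) (hSS : MaxContactCut.SequenceToStepAll) : MaxContactCut.StepPICoreDimFour :=
  (MaxContactCutTauLadder.closes h5 r4 r3 r2 (closes hG hS) hSS).2.2.2.2

/-- MAP EDGE to g7's located residual `ClosedPointCoreAll` (30461) BY NAME: with `E 2` and the two rounds of
GenericPointCut the two halves give the closed-point core. [folklore] -/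
theorem closes_closedPointCore (hE2 : E 2) (h2 : MaxContactCut.RoundCodimTwoAll)
    (h3 : MaxContactCut.RoundCodimThreeAll) (hG : MaxContactCut.FFGenericRung) (hS : MaxContactCut.FFSpecialRung) :
    MaxContactCut.ClosedPointCoreAll :=
  (MaxContactCutGenericPointCut.rungOne_iff_core_of_rounds hE2 h2 h3).mp (closes hG hS)

/-- **DIM-4 LEDGER BY NAME**: with the booked ladder items the two halves give the whole dim-4 step 28011 and the
pencil pocket (`MaxContactCutTauLadder.closes_items`). [folklore] -/
theorem dimFour_of_pieces (hB : MaxContactCut.OrderBound) (h1 : MaxContactCut.LocalOrderOneResolveDimFour)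
    (hM : MaxContactCut.MarkedThreefoldResolution) (hC : CossartJannsenSaito2020EmbeddedSequenceB.{0})
    (hX : MaxContactCutExhaustion.ExhaustionBridge) (r4 : MaxContactCut.RungFour) (r3 : MaxContactCut.RungThree)
    (r2 : MaxContactCut.RungTwo) (hSS : MaxContactCut.SequenceToStepAll) (hG : MaxContactCut.FFGenericRung)
    (hS : MaxContactCut.FFSpecialRung) : MaxContactCut.StepDimFour ∧ OrderCut.PencilResolveDimFour :=
  MaxContactCutTauLadder.closes_items hB h1 hM hC hX r4 r3 r2 (closes hG hS) hSS

end Summit.ResolutionOfSingularities.ResolutionOfSingularities.Theorems.MaxContactCutFaceFormCut
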